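import Literature.AlgebraicGeometry.CossartPiltant200819.TowerInheritance2008
import HarnessLib

/-!
# Cossart–Piltant 2008, Thm 7.2: the bare tower (`GaloisTowerExists2008` minus T-e, T-f/p.i.)

Sequel of `GaloisTower2008.lean` and `TowerInheritance2008.lean`. The moves `GMove3` of the
normal-form-free tower carry, besides the field-theoretic data of each step of the proof of
[CossartPiltant2008] Thm 7.2 (HAL pp. 20–21), four BOOKKEEPING hypotheses on the source stage —
`K/k` finitely generated, `trdeg_k K = 3`, `V` of rank one, `κ(V)/k` algebraic — and, at a purely
inseparable step `K ⊂ K(η)`, `η^p ∈ K`, the uniqueness of the extension of `V`. None of them is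
an obligation of the printed proof: the four are hypotheses of Thm 7.2 on `(K, V)` inherited by
every stage of the tower (finite extensions and restrictions), and a radicial extension extends
valuation rings uniquely. This file removes them:

* `VState.Adm` — the four bookkeeping conditions on a stage; `VState.Adm.up`/`.down` — they pass
  up and down a finite extension (`TowerInheritance2008`); `adm_baseStage` — the base stage
  `(k(x), V ∩ k(x))` satisfies them;
* `BMove3` — the constructors of `GMove3` with the bookkeeping hypotheses deleted (and `huniq`
  deleted from `inseparableP`); `BReach3` its reflexive-transitive closure;
* `BMove3.adm_and_toGMove3`, `BReach3.adm_and_toGReach3` — PROVED: from an admissible stage a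
  bare move is a `GMove3` and lands in an admissible stage; conversely `GMove3.toBMove3`;
* `BareTowerExists2008 k` — NAMED FACT: `GaloisTowerExists2008 k` with `BReach3` in place of
  `GReach3`; `bareTowerExists2008_iff` — PROVED equivalent to `GaloisTowerExists2008 k`;
* `towerExists2008_of_bareTower`, `reductionToArtinSchreier_of_bareTower`,
  `lu3DiffFinite_of_bareTower` — Thm 7.2 and the main theorem from the leaves with the bare fact.

What `BareTowerExists2008` still asserts beyond Mathlib (the cell's clause ledger): T-a(ii) the
purely inseparable part `K₁ ⊂ K` of `K/k(x)` is a tower of simple radical steps of degree `p`;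
T-b Hilbert ramification theory of `W/V₀` in the Galois closure `L/K₀` (inertia and
ramification groups and fields, `G_r⁰` a `p`-group, lemma 6.1 `Gᵢ = Gᵢ⁰ ∩ G`) and the central
series cutting `K₀ʳ ⊆ Kʳ` into Galois steps of degree `p`; T-c the dichotomy "immediate, or
`e = ℓ` or `f = ℓ`" for a rank-one valuation in an extension of prime degree `ℓ` (fundamental
inequality with defect); T-f (Galois half) uniqueness of `W ∩ M'` over `W ∩ M` for the steps
above the decomposition field — discharged pointwise by `comap_eq_of_forall_smul_eq`, but the
inclusion `K₀ᶻ ⊆ K₀ʳ` is part of T-b; T-g the assembly of the chain.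

## References

* V. Cossart, O. Piltant, *Resolution of singularities of threefolds in positive characteristic.
  I*, J. Algebra 320 (2008) 1051–1082 = HAL hal-00139124, Thm 7.2 and its proof, pp. 19–21
  (HAL). [CossartPiltant2008]
-/

namespace Literature.AlgebraicGeometry.CossartPiltant200819.CP2008

open Literature.AlgebraicGeometry.Resolution IntermediateField
open scoped Pointwise

universe u

/-! ### Admissible stages -/

/-- **The bookkeeping conditions on a stage `(K, V)`** — the standing hypotheses of Thm 7.2:
`K/k` finitely generated, `trdeg_k K = 3`, `V` of rank one, `κ(V)` algebraic over `k`.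
[cite: CossartPiltant2008, Thm 7.2 (HAL p. 19)] -/
def VState.Adm {k : Type u} [Field k] (s : VState k) : Prop :=
  (⊤ : IntermediateField k s.K).FG ∧ Algebra.trdeg k s.K = 3 ∧
    Nonempty s.O.valuation.RankOne ∧ residueTrdeg k s.O s.algebraMap_mem = 0

section Adm

variable {k K L : Type u} [Field k] [Field K] [Field L] [Algebra k K] [Algebra K L] [Algebra k L]
  [IsScalarTower k K L]

/-- **Admissibility passes up a finite extension** `(K, W ∩ K) ↦ (L, W)`. [folklore] -/
theorem VState.Adm.up [FiniteDimensional K L] (W : ValuationSubring L)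
    (hkW : ∀ c : k, algebraMap k L c ∈ W)
    (h : VState.Adm ⟨K, W.comap (algebraMap K L), forall_algebraMap_mem_comap hkW⟩) :
    VState.Adm ⟨L, W, hkW⟩ := by
  dsimp only [VState.Adm] at h ⊢
  obtain ⟨hfg, h3, h1, halg⟩ := h
  exact ⟨intermediateField_fg_top_of_finite hfg,
    (trdeg_eq_of_isAlgebraic' (K := K) (L := L)).trans h3,
    nonempty_rankOne_of_comap_of_isAlgebraic W h1, residueTrdeg_eq_zero_of_comap W hkW halg⟩

/-- **Admissibility passes down a finite extension** `(L, W) ↦ (K, W ∩ K)`. [folklore] -/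
theorem VState.Adm.down [FiniteDimensional K L] (W : ValuationSubring L)
    (hkW : ∀ c : k, algebraMap k L c ∈ W) (h : VState.Adm ⟨L, W, hkW⟩) :
    VState.Adm ⟨K, W.comap (algebraMap K L), forall_algebraMap_mem_comap hkW⟩ := by
  dsimp only [VState.Adm] at h ⊢
  obtain ⟨hfg, h3, h1, halg⟩ := h
  exact ⟨fg_top_of_fg_top_of_finite (K := K) hfg,
    (trdeg_eq_of_isAlgebraic' (K := K) (L := L)).symm.trans h3,
    nonempty_rankOne_comap_of_isAlgebraic W h1, residueTrdeg_comap_eq_zero W hkW halg⟩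

/-- `k → K' → L` is a scalar tower, for an intermediate field `K'` of the top floor of a tower
`k → K → L` (Mathlib registers `k → K → K'` and `K → K' → L` only). [folklore] -/
theorem isScalarTower_intermediateField' (K' : IntermediateField K L) : IsScalarTower k K' L :=
  IsScalarTower.of_algebraMap_eq fun c => by
    rw [IsScalarTower.algebraMap_apply k K K' c, ← IsScalarTower.algebraMap_apply K K' L,
      ← IsScalarTower.algebraMap_apply k K L]

omit [Algebra K L] [Algebra k L] [IsScalarTower k K L] in
/-- **The base stage `(k(x), V ∩ k(x))` is admissible** (`k(x)/k` finitely generated by `x`,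
`K/k(x)` algebraic). [folklore] -/
theorem adm_baseStage (h3 : Algebra.trdeg k K = 3) (O : ValuationSubring K)
    (hk : ∀ c : k, algebraMap k K c ∈ O) (h1 : Nonempty O.valuation.RankOne)
    (halg : residueTrdeg k O hk = 0) (x : Fin 3 → K) (hx : IsTranscendenceBasis k x) :
    (baseStage x O hk).Adm := by
  haveI := hx.isAlgebraic_field
  dsimp only [VState.Adm, baseStage]
  refine ⟨?_, ?_, nonempty_rankOne_comap_of_isAlgebraic O h1, residueTrdeg_comap_eq_zero O hk halg⟩
  · exact IntermediateField.fg_top_iff.mpr (IntermediateField.essFiniteType_iff.mpr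
      (IntermediateField.fg_adjoin_of_finite (Set.finite_range x)))
  · rw [← trdeg_eq_of_isAlgebraic' (K := ↥(IntermediateField.adjoin k (Set.range x))) (L := K)]
    exact h3

end Adm

/-! ### Bare moves -/

/-- **One step of the proof of Thm 7.2, bare**: the constructors of `GMove3` with the inherited
bookkeeping hypotheses (`hfg`, `h3`, `h1`, `halg`) deleted, and `huniq` deleted from the purely
inseparable step (a radicial extension extends valuation rings uniquely,
`eq_of_comap_eq_of_isPurelyInseparable`). What each constructor keeps is the field-theoretic
content of the step in the source: `inertiaUp` — into the inertia field of a finite Galois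
`L/K` (Cor 6.3); `primeUp` — prime degree with `f = ℓ` or `e = ℓ` (Prop 8.3); `galoisP` —
Galois of degree `p`, `W` the only extension of `V`, immediate (HAL p. 21 l. 24–28);
`inseparableP` — `k` imperfect, `L = K(η)`, `η^p ∈ K`, `[L:K] = p`, immediate (HAL p. 20
l. 17–28); `ramificationDown` — from the ramification field down (Prop 9.5); `iso` — renaming.
[cite: CossartPiltant2008, Thm 7.2 proof (HAL pp. 20–21)] -/
inductive BMove3 (k : Type u) [Field k] : VState k → VState k → Prop
  | inertiaUp {K : Type u} [Field K] [Algebra k K] {L : Type u} [Field L] [Algebra K L]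
      [Algebra k L] [IsScalarTower k K L] (hfin : FiniteDimensional K L) (hgal : IsGalois K L)
      (W : ValuationSubring L) (hkW : ∀ c : k, algebraMap k L c ∈ W) (K' : IntermediateField K L)
      (hK' : LeInertiaField K W K') :
      BMove3 k ⟨K, W.comap (algebraMap K L), forall_algebraMap_mem_comap hkW⟩
        ⟨K', W.comap (algebraMap K' L), forall_algebraMap_mem_comap_intermediateField hkW K'⟩
  | primeUp {K : Type u} [Field K] [Algebra k K] {L : Type u} [Field L] [Algebra K L]
      [Algebra k L] [IsScalarTower k K L] (hprime : (Module.finrank K L).Prime)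
      (W : ValuationSubring L) (hkW : ∀ c : k, algebraMap k L c ∈ W)
      (hef : inertiaDegree K W = Module.finrank K L ∨ ramificationIndex K W = Module.finrank K L) :
      BMove3 k ⟨K, W.comap (algebraMap K L), forall_algebraMap_mem_comap hkW⟩ ⟨L, W, hkW⟩
  | galoisP {K : Type u} [Field K] [Algebra k K] (O : ValuationSubring K)
      (hk : ∀ c : k, algebraMap k K c ∈ O) (p : ℕ) (hp : p.Prime) (hchar : CharP k p)
      {L : Type u} [Field L] [Algebra K L] [Algebra k L] [IsScalarTower k K L]
      (hfin : FiniteDimensional K L) (hgal : IsGalois K L) (hdeg : Module.finrank K L = p)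
      (W : ValuationSubring L) (hkW : ∀ c : k, algebraMap k L c ∈ W)
      (hWO : W.comap (algebraMap K L) = O)
      (huniq : ∀ W' : ValuationSubring L, W'.comap (algebraMap K L) = O → W' = W)
      (himm : IsImmediate K W) :
      BMove3 k ⟨K, O, hk⟩ ⟨L, W, hkW⟩
  | inseparableP {K : Type u} [Field K] [Algebra k K] (O : ValuationSubring K)
      (hk : ∀ c : k, algebraMap k K c ∈ O) (p : ℕ) (hp : p.Prime) (hchar : CharP k p)
      (hkp : ¬ PerfectField k) {L : Type u} [Field L] [Algebra K L] [Algebra k L]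
      [IsScalarTower k K L] (hfin : FiniteDimensional K L) (hdeg : Module.finrank K L = p)
      (η : L) (b₀ : K) (hη : η ^ p = algebraMap K L b₀) (hηtop : K⟮η⟯ = ⊤)
      (W : ValuationSubring L) (hkW : ∀ c : k, algebraMap k L c ∈ W)
      (hWO : W.comap (algebraMap K L) = O) (himm : IsImmediate K W) :
      BMove3 k ⟨K, O, hk⟩ ⟨L, W, hkW⟩
  | ramificationDown {K : Type u} [Field K] [Algebra k K] {L : Type u} [Field L] [Algebra K L]
      [Algebra k L] [IsScalarTower k K L] (hfin : FiniteDimensional K L) (hgal : IsGalois K L)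
      (W : ValuationSubring L) (hkW : ∀ c : k, algebraMap k L c ∈ W) (K' : IntermediateField K L)
      (hK' : LeRamificationField K W K') :
      BMove3 k ⟨K', W.comap (algebraMap K' L), forall_algebraMap_mem_comap_intermediateField hkW K'⟩
        ⟨K, W.comap (algebraMap K L), forall_algebraMap_mem_comap hkW⟩
  | iso {K₁ K₂ : Type u} [Field K₁] [Algebra k K₁] [Field K₂] [Algebra k K₂] (e : K₁ ≃ₐ[k] K₂)
      (O : ValuationSubring K₂) (hk : ∀ c : k, algebraMap k K₂ c ∈ O) :
      BMove3 k ⟨K₁, O.comap (e : K₁ →+* K₂), forall_algebraMap_mem_comap_algEquiv e hk⟩ ⟨K₂, O, hk⟩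

/-- **Finitely many bare steps.** [folklore] -/
def BReach3 (k : Type u) [Field k] : VState k → VState k → Prop :=
  Relation.ReflTransGen (BMove3 k)

/-- **Forgetting the bookkeeping**: every `GMove3` is a bare move. [folklore] -/
theorem GMove3.toBMove3 {k : Type u} [Field k] {s t : VState k} (h : GMove3 k s t) :
    BMove3 k s t := by
  cases h with
  | inertiaUp hfg h3 hfin hgal W hkW K' hK' => exact BMove3.inertiaUp hfin hgal W hkW K' hK'
  | primeUp hfg h3 hprime W hkW h1 hef => exact BMove3.primeUp hprime W hkW hef
  | galoisP hfg h3 O hk h1 halg p hp hchar hfin hgal hdeg W hkW hWO huniq himm =>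
    exact BMove3.galoisP O hk p hp hchar hfin hgal hdeg W hkW hWO huniq himm
  | inseparableP hfg h3 O hk h1 halg p hp hchar hkp hfin hdeg η b₀ hη hηtop W hkW hWO huniq himm =>
    exact BMove3.inseparableP O hk p hp hchar hkp hfin hdeg η b₀ hη hηtop W hkW hWO himm
  | ramificationDown hfg h3 hfin hgal W hkW h1 halg K' hK' =>
    exact BMove3.ramificationDown hfin hgal W hkW K' hK'
  | iso e O hk => exact BMove3.iso e O hk

/-- **Inheritance along one step** — PROVED (clauses T-e and T-f, purely inseparable half): from an
admissible stage, a bare move lands in an admissible stage and is a `GMove3`; the deleted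
hypotheses are supplied by `VState.Adm.up`/`.down` (finite generation, `trdeg 3`, rank one,
residual algebraicity along finite extensions and restrictions) and by
`eq_of_comap_eq_of_isPurelyInseparable` (uniqueness over `K(η)`, `η^p ∈ K`). [folklore] -/
theorem BMove3.adm_and_toGMove3 {k : Type u} [Field k] {s t : VState k} (h : BMove3 k s t)
    (hs : s.Adm) : t.Adm ∧ GMove3 k s t := by
  cases h with
  | @inertiaUp K _ _ L _ _ _ _ hfin hgal W hkW K' hK' =>
    haveI := hfin
    haveI := isScalarTower_intermediateField' (k := k) K'
    have ht := (VState.Adm.up W hkW hs).down (K := ↥K') W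
      (fun c => forall_algebraMap_mem_comap_intermediateField hkW K' c)
    have hs' := hs
    dsimp only [VState.Adm] at hs'
    obtain ⟨hfg, h3, -, -⟩ := hs'
    exact ⟨ht, GMove3.inertiaUp hfg h3 hfin hgal W hkW K' hK'⟩
  | @primeUp K _ _ L _ _ _ _ hprime W hkW hef =>
    haveI : FiniteDimensional K L := Module.finite_of_finrank_pos hprime.pos
    have ht := VState.Adm.up W hkW hs
    have hs' := hs
    have ht' := ht
    dsimp only [VState.Adm] at hs' ht'
    obtain ⟨hfg, h3, -, -⟩ := hs'
    obtain ⟨-, -, h1, -⟩ := ht'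
    exact ⟨ht, GMove3.primeUp hfg h3 hprime W hkW h1 hef⟩
  | @galoisP K _ _ O hk p hp hchar L _ _ _ _ hfin hgal hdeg W hkW hWO huniq himm =>
    subst hWO
    haveI := hfin
    have ht := VState.Adm.up W hkW hs
    have hs' := hs
    dsimp only [VState.Adm] at hs'
    obtain ⟨hfg, h3, h1, halg⟩ := hs'
    exact ⟨ht, GMove3.galoisP hfg h3 _ hk h1 halg p hp hchar hfin hgal hdeg W hkW rfl huniq himm⟩
  | @inseparableP K _ _ O hk p hp hchar hkp L _ _ _ _ hfin hdeg η b₀ hη hηtop W hkW hWO himm =>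
    subst hWO
    haveI := hfin
    haveI := Fact.mk hp
    haveI := hchar
    haveI : CharP K p := charP_of_injective_algebraMap (algebraMap k K).injective p
    haveI : IsPurelyInseparable K L := isPurelyInseparable_of_pthRoot hη hηtop
    have huniq : ∀ W' : ValuationSubring L,
        W'.comap (algebraMap K L) = W.comap (algebraMap K L) → W' = W :=
      fun W' hW' => eq_of_comap_eq_of_isPurelyInseparable hW'
    have ht := VState.Adm.up W hkW hs
    have hs' := hs
    dsimp only [VState.Adm] at hs'
    obtain ⟨hfg, h3, h1, halg⟩ := hs'
    exact ⟨ht, GMove3.inseparableP hfg h3 _ hk h1 halg p hp hchar hkp hfin hdeg η b₀ hη hηtop W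
      hkW rfl huniq himm⟩
  | @ramificationDown K _ _ L _ _ _ _ hfin hgal W hkW K' hK' =>
    haveI := hfin
    haveI := isScalarTower_intermediateField' (k := k) K'
    have hL : VState.Adm ⟨L, W, hkW⟩ :=
      VState.Adm.up (K := ↥K') W hkW hs
    have ht := hL.down (K := K) W
    have hL' := hL
    have ht' := ht
    dsimp only [VState.Adm] at hL' ht'
    obtain ⟨-, -, h1, halg⟩ := hL'
    obtain ⟨hfg, h3, -, -⟩ := ht'
    exact ⟨ht, GMove3.ramificationDown hfg h3 hfin hgal W hkW h1 halg K' hK'⟩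
  | @iso K₁ K₂ _ _ _ _ e O hk =>
    letI : Algebra K₁ K₂ := (e : K₁ →+* K₂).toAlgebra
    haveI : IsScalarTower k K₁ K₂ := IsScalarTower.of_algebraMap_eq fun c => (e.commutes c).symm
    haveI : FiniteDimensional K₁ K₂ :=
      Module.Finite.of_surjective (Algebra.linearMap K₁ K₂) fun y =>
        ⟨e.symm y, e.apply_symm_apply y⟩
    exact ⟨VState.Adm.up (K := K₁) O hk hs, GMove3.iso e O hk⟩

/-- **Inheritance along the tower** — PROVED: a bare chain from an admissible stage is a
`GMove3`-chain through admissible stages. [folklore] -/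
theorem BReach3.adm_and_toGReach3 {k : Type u} [Field k] {s t : VState k} (h : BReach3 k s t)
    (hs : s.Adm) : t.Adm ∧ GReach3 k s t := by
  induction h with
  | refl => exact ⟨hs, Relation.ReflTransGen.refl⟩
  | tail _ hm ih =>
    obtain ⟨hb, hr⟩ := ih
    obtain ⟨hc, hg⟩ := hm.adm_and_toGMove3 hb
    exact ⟨hc, Relation.ReflTransGen.tail hr hg⟩

/-- The forgetful direction for chains. [folklore] -/
theorem GReach3.toBReach3 {k : Type u} [Field k] {s t : VState k} (h : GReach3 k s t) :
    BReach3 k s t := by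
  induction h with
  | refl => exact Relation.ReflTransGen.refl
  | tail _ hm ih => exact Relation.ReflTransGen.tail ih hm.toBMove3

/-! ### The bare tower fact -/

/-- **The tower of the proof of Thm 7.2 exists, bare** (Cossart–Piltant 2008, HAL pp. 20–21) —
NAMED FACT, `GaloisTowerExists2008` with clauses T-e (inheritance of the bookkeeping hypotheses)
and T-f/purely-inseparable (uniqueness of the extension of `V` to `K(η)`) removed: for `k` of
characteristic `p > 0`, `K/k` finitely generated of transcendence degree three, `V` a
`k`-valuation ring of `K` of rank one with `κ(V)/k` algebraic, and any transcendence basis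
`x` of `K/k` with `K/k(x)` separable if `k` is perfect, the stage `(K, V)` is reached from
`(k(x), V ∩ k(x))` by finitely many BARE moves `BMove3`.
[cite: CossartPiltant2008, Thm 7.2 proof (HAL pp. 20–21)] -/
def BareTowerExists2008 (k : Type u) [Field k] : Prop :=
  ∀ (p : ℕ), p.Prime → CharP k p →
  ∀ (K : Type u) [Field K] [Algebra k K], (⊤ : IntermediateField k K).FG → Algebra.trdeg k K = 3 →
  ∀ (O : ValuationSubring K) (hk : ∀ c : k, algebraMap k K c ∈ O), Nonempty O.valuation.RankOne →
    residueTrdeg k O hk = 0 →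
  ∀ (x : Fin 3 → K), IsTranscendenceBasis k x →
    (PerfectField k → Algebra.IsSeparable (IntermediateField.adjoin k (Set.range x)) K) →
    BReach3 k (baseStage x O hk) ⟨K, O, hk⟩

/-- **`GaloisTowerExists2008` from the bare tower** — PROVED: the base stage is admissible
(`adm_baseStage`) and admissibility is inherited along the chain (`BReach3.adm_and_toGReach3`).
[cite: CossartPiltant2008, Thm 7.2 proof (HAL pp. 20–21)] -/
theorem galoisTowerExists2008_of_bareTower {k : Type u} [Field k] (hB : BareTowerExists2008 k) :
    GaloisTowerExists2008 k := by
  intro p hp hchar K _ _ hfg h3 O hk h1 halg x hx hsep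
  exact ((hB p hp hchar K hfg h3 O hk h1 halg x hx hsep).adm_and_toGReach3
    (adm_baseStage h3 O hk h1 halg x hx)).2

/-- **The two tower facts are equivalent.** [folklore] -/
theorem bareTowerExists2008_iff {k : Type u} [Field k] :
    BareTowerExists2008 k ↔ GaloisTowerExists2008 k :=
  ⟨galoisTowerExists2008_of_bareTower, fun hG p hp hchar K _ _ hfg h3 O hk h1 halg x hx hsep =>
    (hG p hp hchar K hfg h3 O hk h1 halg x hx hsep).toBReach3⟩

/-- **`TowerExists2008` from the bare tower** — PROVED. [cite: CossartPiltant2008, Thm 7.2 proof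
(HAL pp. 20–21)] -/
theorem towerExists2008_of_bareTower {k : Type u} [Field k] (hB : BareTowerExists2008 k) :
    TowerExists2008 k :=
  towerExists2008_of_galoisTower (galoisTowerExists2008_of_bareTower hB)

/-- **Cossart–Piltant 2008, Theorem 7.2 from its leaves, with the bare tower** — PROVED: Cor 6.3,
Prop 8.3, Prop 9.5 and `BareTowerExists2008` give `ReductionToArtinSchreier`.
[cite: CossartPiltant2008, Thm 7.2 (HAL pp. 19–21)] -/
theorem reductionToArtinSchreier_of_bareTower (h63 : ClimbToInertiaField.{u})
    (h83 : PrimeDegreeAscent.{u}) (h95 : DescentBelowRamificationField.{u})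
    (hB : ∀ (k : Type u) [Field k], BareTowerExists2008 k) : ReductionToArtinSchreier.{u} :=
  reductionToArtinSchreier_of_galoisTower h63 h83 h95
    fun k _ => galoisTowerExists2008_of_bareTower (hB k)

/-- **The local uniformization theorem of Cossart–Piltant 2008 (`LU3DiffFinite`) from its leaves,
with the bare tower** — PROVED: Prop 5.1, Cor 6.3, Prop 8.3, Prop 9.5, `BareTowerExists2008` and
[CP2]'s Main theorem. [cite: CossartPiltant2008, Thm 2.1 proof (HAL pp. 3–4, 16, 19–21)] -/
theorem lu3DiffFinite_of_bareTower (p51 : RankReduction.{u}) (h63 : ClimbToInertiaField.{u})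
    (h83 : PrimeDegreeAscent.{u}) (h95 : DescentBelowRamificationField.{u})
    (hB : ∀ (k : Type u) [Field k], BareTowerExists2008 k) (cp2 : CossartPiltant2009Main.{u}) :
    LU3DiffFinite.{u} :=
  lu3DiffFinite_of_galoisTower p51 h63 h83 h95
    (fun k _ => galoisTowerExists2008_of_bareTower (hB k)) cp2

end Literature.AlgebraicGeometry.CossartPiltant200819.CP2008
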